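import Summits.QuantumAdvantage.QuantumAdvantage.Theorems.CharDialTokenDialD2
import HarnessLib

/-!
# CharDial tower — the TOKEN DIAL, part D: the LOCAL ENGINE INEQUALITY (§8b)

Cell `decomp-qadv`, lens 6, generation 19 (REV1); supports stmt-QuantumAdvantage-27206 / 27207 (crux 32604).  Imports part D2
(module name `CharDialTokenDialD` so that parts E/F import it unchanged).

★ `engineLoc`: for a junta ⊕ `𝔽_p`-form presentation `D`, an adjacent pair `(s, t = s+1)` and ANY set `G` of cuts outside which the
pair is dead (`3 ∤ p`):
`3·#WIN_c + #richLoc ≤ 3·2ⁿ + 8·p^{|G ∪ {t}|}·2^{Σ_{g ∈ G ∪ {t}} |J_g|}·(2cos(π/(3p)))ⁿ`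
— part D1's pairing `2·#WIN + |flipE| ≤ 2·2ⁿ`, part D2's cover of the rich set by active multi-form cells, two flipping thirds per
cell (`sum_flip_le_flipE`), and the two-moduli error per cell.  With `G = ∅` it contains part A's `engine` (`rset_subset_richLoc`).
0 sorry.  Part E turns it into the seventh dial `tokenLoc_hard K` (at most `K` readers, rich set `≥ 2ⁿ/(4p)`).
-/

set_option autoImplicit false

namespace Summit.QuantumAdvantage.AdviceFreeQNC0.JLinPeel.TokenDial

open Finset SegMove

variable {n : ℕ}

section LocEngine

variable {p : ℕ} [hp : Fact p.Prime]

/-- **(counting the flip cells)** `Σ_{relevant cells} (#res1 part + #res2 part) ≤ |flipE|`. -/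
theorem sum_flip_le_flipE (c : ℕ) (D : JLinData p n) (s t : Fin n) (hst : t.val = s.val + 1)
    (G G' : Finset (Fin (n + 1))) (hGG : G ⊆ G') (htG : cut t ∈ G')
    (hG : ∀ g, g ∉ G → D.a g s = D.a g t ∧ s ∉ D.J g ∧ t ∉ D.J g)
    (O : Finset (Fin n)) (hsO : s ∈ O) (htO : t ∈ O) (hJO : ∀ g ∈ G', D.J g ⊆ O) :
    ∑ TV ∈ idxM D G' O s t,
        (((cellM O (patt TV.1) (formsOf D G') TV.2).filter fun u =>
            addr c u t.val = res1 (decB D TV.1 TV.2 (cut t)) (decA D G' s t TV.1 TV.2 (cut t))).card +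
          ((cellM O (patt TV.1) (formsOf D G') TV.2).filter fun u =>
            addr c u t.val = res2 (decB D TV.1 TV.2 (cut t)) (decA D G' s t TV.1 TV.2 (cut t)) (patt TV.1 s)).card)
      ≤ (flipE c D.strat s t).card := by
  classical
  have hsum : ∀ TV ∈ idxM D G' O s t,
      ((cellM O (patt TV.1) (formsOf D G') TV.2).filter fun u =>
          addr c u t.val = res1 (decB D TV.1 TV.2 (cut t)) (decA D G' s t TV.1 TV.2 (cut t))).card +
        ((cellM O (patt TV.1) (formsOf D G') TV.2).filter fun u =>
          addr c u t.val = res2 (decB D TV.1 TV.2 (cut t)) (decA D G' s t TV.1 TV.2 (cut t)) (patt TV.1 s)).card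
      = (flipCellM c D G' O s t TV).card := by
    intro TV _
    unfold flipCellM
    rw [filter_or, card_union_of_disjoint]
    rw [disjoint_filter]
    intro u _ h1 h2
    exact res1_ne_res2 _ _ _ (h1.symm.trans h2)
  rw [sum_congr rfl hsum, ← card_biUnion]
  · exact card_le_card (biUnion_subset.2 fun TV hTV =>
      flipCellM_subset c D s t hst G G' hGG htG hG O hsO htO hJO TV hTV)
  · intro TV hTV TV' hTV' hne
    have h1 := ((mem_idxM D G' O s t TV).1 hTV).1.1
    have h2 := ((mem_idxM D G' O s t TV').1 hTV').1.1
    unfold flipCellM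
    exact disjoint_filter_filter (cellM_disjoint O (formsOf D G') h1 h2 (by
      intro h; apply hne; exact Prod.ext (congrArg Prod.fst h) (congrArg Prod.snd h)))

/-- ★ **THE LOCAL ENGINE INEQUALITY.** for a junta ⊕ `𝔽_p`-form presentation, an adjacent pair `(s, t = s+1)` and a set `G`
of cuts outside which the pair is dead (`3 ∤ p`):
`3·#WIN_c + #richLoc ≤ 3·2ⁿ + 8·p^{|G ∪ {t}|}·2^{Σ_{g ∈ G ∪ {t}} |J_g|}·(2cos(π/(3p)))ⁿ`. -/
theorem engineLoc (hp3 : p ≠ 3) (c : ℕ) (D : JLinData p n) (s t : Fin n) (hst : t.val = s.val + 1)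
    (G : Finset (Fin (n + 1))) (hG : ∀ g, g ∉ G → D.a g s = D.a g t ∧ s ∉ D.J g ∧ t ∉ D.J g) :
    3 * ((univ.filter fun u : Fin n → Bool => ringWinU c D.strat u = true).card : ℝ)
      + ((richLoc D.strat s t).card : ℝ)
      ≤ 3 * (2 : ℝ) ^ n + 8 * (p : ℝ) ^ (insert (cut t) G).card *
          (2 : ℝ) ^ (∑ g ∈ insert (cut t) G, (D.J g).card) * (2 * Real.cos (Real.pi / (3 * p))) ^ n := by
  classical
  set G' : Finset (Fin (n + 1)) := insert (cut t) G with hG'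
  have hGG : G ⊆ G' := subset_insert _ _
  have htG : cut t ∈ G' := mem_insert_self _ _
  set O : Finset (Fin n) := insert s (insert t (G'.biUnion D.J)) with hO
  have hJO : ∀ g ∈ G', D.J g ⊆ O := fun g hg i hi => by
    rw [hO]; exact mem_insert_of_mem (mem_insert_of_mem (mem_biUnion.2 ⟨g, hg, hi⟩))
  have hsO : s ∈ O := by rw [hO]; exact mem_insert_self _ _
  have htO : t ∈ O := by rw [hO]; exact mem_insert_of_mem (mem_insert_self _ _)
  have hOcard : O.card ≤ (∑ g ∈ G', (D.J g).card) + 2 := by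
    rw [hO]
    refine (card_insert_le _ _).trans ?_
    have h1 := card_insert_le t (G'.biUnion D.J)
    have h2 : (G'.biUnion D.J).card ≤ ∑ g ∈ G', (D.J g).card := card_biUnion_le
    omega
  set err : ℝ := 2 * (2 * Real.cos (Real.pi / (3 * p))) ^ n with herr
  -- (1) the pairing inequality
  have hpair := flip_pairing c D.strat s t hst
  -- (2) the rich set is covered by the relevant cells
  have hR : ((richLoc D.strat s t).card : ℝ)
      ≤ ∑ TV ∈ idxM D G' O s t, ((cellM O (patt TV.1) (formsOf D G') TV.2).card : ℝ) := by
    have h := (card_le_card (richLoc_subset D G' O s t hst hsO htO htG hJO)).trans card_biUnion_le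
    exact_mod_cast h
  -- (3) the flip cells fit into flipE
  have hE := sum_flip_le_flipE c D s t hst G G' hGG htG hG O hsO htO hJO
  -- (4) per cell: two thirds, up to err each
  have hcell : ∀ TV ∈ idxM D G' O s t,
      2 * ((cellM O (patt TV.1) (formsOf D G') TV.2).card : ℝ) ≤
        3 * ((((cellM O (patt TV.1) (formsOf D G') TV.2).filter fun u =>
            addr c u t.val = res1 (decB D TV.1 TV.2 (cut t)) (decA D G' s t TV.1 TV.2 (cut t))).card +
          ((cellM O (patt TV.1) (formsOf D G') TV.2).filter fun u =>
            addr c u t.val = res2 (decB D TV.1 TV.2 (cut t)) (decA D G' s t TV.1 TV.2 (cut t)) (patt TV.1 s)).card : ℕ) : ℝ)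
        + 2 * err := by
    intro TV _
    have h0 := cell_le_three_addrM hp3 c O (patt TV.1) (formsOf D G') TV.2 t _ (res1_lt (decB D TV.1 TV.2 (cut t))
      (decA D G' s t TV.1 TV.2 (cut t)))
    have h1 := cell_le_three_addrM hp3 c O (patt TV.1) (formsOf D G') TV.2 t _ (res2_lt (decB D TV.1 TV.2 (cut t))
      (decA D G' s t TV.1 TV.2 (cut t)) (patt TV.1 s))
    push_cast at h0 h1 ⊢
    linarith
  have hsum := sum_le_sum hcell
  rw [← mul_sum, sum_add_distrib, ← mul_sum, sum_const, nsmul_eq_mul] at hsum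
  -- (5) sizes
  have hidx : ((idxM D G' O s t).card : ℝ) ≤ 4 * (2 : ℝ) ^ (∑ g ∈ G', (D.J g).card) * (p : ℝ) ^ G'.card := by
    have h := card_idxM_le D G' O s t
    have h2 : (2 : ℕ) ^ O.card ≤ 2 ^ ((∑ g ∈ G', (D.J g).card) + 2) := Nat.pow_le_pow_right (by norm_num) hOcard
    have h3 : (idxM D G' O s t).card ≤ 2 ^ ((∑ g ∈ G', (D.J g).card) + 2) * p ^ G'.card :=
      h.trans (Nat.mul_le_mul_right _ h2)
    have h4 : ((idxM D G' O s t).card : ℝ) ≤ ((2 ^ ((∑ g ∈ G', (D.J g).card) + 2) * p ^ G'.card : ℕ) : ℝ) := by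
      exact_mod_cast h3
    refine h4.trans (le_of_eq ?_)
    push_cast
    ring
  have herr0 : 0 ≤ err := by
    rw [herr]
    have hcos : 0 ≤ Real.cos (Real.pi / (3 * p)) := by
      apply Real.cos_nonneg_of_neg_pi_div_two_le_of_le
      · have : 0 ≤ Real.pi / (3 * p) := by positivity
        linarith [Real.pi_pos]
      · rw [div_le_div_iff₀ (by have := hp.out.pos; positivity) (by norm_num)]
        have : (2 : ℝ) ≤ p := by exact_mod_cast hp.out.two_le
        nlinarith [Real.pi_pos]
    positivity
  have hpairR : 2 * ((univ.filter fun u : Fin n → Bool => ringWinU c D.strat u = true).card : ℝ)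
      + ((flipE c D.strat s t).card : ℝ) ≤ 2 * (2 : ℝ) ^ n := by exact_mod_cast hpair
  have hER : ((∑ TV ∈ idxM D G' O s t,
      (((cellM O (patt TV.1) (formsOf D G') TV.2).filter fun u =>
          addr c u t.val = res1 (decB D TV.1 TV.2 (cut t)) (decA D G' s t TV.1 TV.2 (cut t))).card +
        ((cellM O (patt TV.1) (formsOf D G') TV.2).filter fun u =>
          addr c u t.val = res2 (decB D TV.1 TV.2 (cut t)) (decA D G' s t TV.1 TV.2 (cut t)) (patt TV.1 s)).card) : ℕ) : ℝ)
      ≤ ((flipE c D.strat s t).card : ℝ) := by exact_mod_cast hE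
  push_cast at hER hsum
  have hpp : (0 : ℝ) ≤ 4 * (2 : ℝ) ^ (∑ g ∈ G', (D.J g).card) * (p : ℝ) ^ G'.card := by positivity
  have hmul : ((idxM D G' O s t).card : ℝ) * (2 * err)
      ≤ 4 * (2 : ℝ) ^ (∑ g ∈ G', (D.J g).card) * (p : ℝ) ^ G'.card * (2 * err) :=
    mul_le_mul_of_nonneg_right hidx (by linarith)
  rw [herr] at hmul
  nlinarith [hR, hsum, hER, hpairR, hmul, herr0]

omit hp in
/-- the dead case is the readerless case: the rich set contains part A's accepted swap set. -/
theorem rset_subset_richLoc (D : JLinData p n) (s t : Fin n) (hst : t.val = s.val + 1)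
    (hdead : ∀ g, D.a g s = D.a g t ∧ s ∉ D.J g ∧ t ∉ D.J g) :
    (univ.filter fun u : Fin n → Bool => u s ≠ u t ∧ D.strat (cut t) u = true) ⊆ richLoc D.strat s t := by
  intro u hu
  rw [mem_filter] at hu
  obtain ⟨-, hne, hacc⟩ := hu
  rw [mem_richLoc]
  exact ⟨hne, fun g _ => dead_strat D s t hst hdead g u hne, Or.inl hacc⟩

end LocEngine

end Summit.QuantumAdvantage.AdviceFreeQNC0.JLinPeel.TokenDial
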